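import Mathlib

/-!
# Connectivity correlation inequalities for `φ_{w,q}`, every `q > 0` — file 64a: **THE ODD-CONE ENGINE** (any number of special edges)

Support file (`--supports stmt-CriticalPhenomena-4575`), FK sub-lane `prim-bschramm-fk-2` (gen 29); builds on p205010 (kernel theorem,
internal audit signed; external expert review pending).  No definitions, no named facts, no sorries; standard axioms.  Memo
FROM-fk-2-g29-BRIDGE.md §14.

THE SHAPE.  Every levelwise `q`-free inequality of this lineage (`C_∞⁺` at level `k`) is a statement about an ANTIPODAL SUM
`L(f) = Σ_{γ ⊆ M', p γ} (f(γ ∪ C) − f((M' \ γ) ∪ C)) · G γ` (`p` = the level cut-off, `G γ = g(γ ∪ C) − g((M' \ γ) ∪ C)`), for an increasing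
`f` reading only a set `S ⊆ M'` of special edges (`S ∩ C = ∅`).  Then `f(γ ∪ C) = φ(γ ∩ S)` and `f((M' \ γ) ∪ C) = φ(S \ (γ ∩ S))`: the sum only
sees the ODD PART `P ↦ φ(P) − φ(S \ P)` of the pattern function `φ` (`sum_antipodal_congr_pattern`).  Two linear-algebra facts turn the finitely
many EXTREME TYPES of level `k` into the inequality for EVERY increasing `f`:
* LAYER CAKE (`pattern_sum_nonpos_of_thresholds`, `sum_antipodal_nonpos_of_thresholds`): `φ = min φ + Σ_j (t_j − t_{j−1})·1{φ ≥ t_j}` over the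
  values of `φ`, so `L(f) ≤ 0` follows from `L ≤ 0` for the THRESHOLD indicators `1{t ≤ f}` (monotone Boolean functions reading `S`) — proved by
  induction on the number of values, peeling the top layer; no monotonicity is needed for the identity itself.
* CONE TRANSFER (`pattern_sum_nonpos_of_cone`): if the odd part of `φ` is a nonnegative combination of the odd parts of functions `ψ_r` with
  `L(ψ_r) ≤ 0`, then `L(φ) ≤ 0`.
At level 3 this is what file 61Ω does by hand (5 rays); at level 4 the cone of odd parts has 23 extreme rays (4 dictators, 5 `AND`, 4 `maj₃`,
6 of type `T1 = zw(x ∨ y)`, 4 of type `T2 = hub·OR ∨ AND`) and the 168 monotone Boolean functions of 4 bits have explicit rational certificates with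
denominators `≤ 4` (memo §14, results/oddcone4): the level-4 master file is these three lemmas + that table + the ray theorems.
[cite: Grimmett2006, §3.8 Thm. (3.90) (pp. 61–62); §3.9 (pp. 63–64)]
-/

noncomputable section

namespace Summit.CriticalPhenomena.PercolationContinuityZ3.Theorems

namespace FK

namespace OddCone

open Finset

variable {α : Type*} [DecidableEq α]

/-- A function reading only the edges of `S` (membership form, as in the level-3 master file) is a function of the pattern `A ∩ S`.
[folklore] -/
theorem apply_eq_apply_inter_of_reads {S : Finset α} {f : Finset α → ℝ}
    (hf : ∀ A B : Finset α, (∀ e ∈ S, (e ∈ A ↔ e ∈ B)) → f A = f B) (A : Finset α) :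
    f A = f (A ∩ S) :=
  hf A (A ∩ S) fun e he => by rw [Finset.mem_inter, and_iff_left he]

/-- **Pattern form of an antipodal sum.**  If `f A = φ (A ∩ S)` with `S ⊆ M'` and `S ∩ C = ∅`, then
`Σ_{γ ⊆ M', p γ} (f(γ ∪ C) − f((M' \ γ) ∪ C))·G γ = Σ_{γ ⊆ M', p γ} (φ(γ ∩ S) − φ(S \ (γ ∩ S)))·G γ`. [folklore] -/
theorem sum_antipodal_congr_pattern {M' C S : Finset α} (hSM : S ⊆ M') (hSC : Disjoint S C)
    (p : Finset α → Prop) [DecidablePred p] (G : Finset α → ℝ) {f φ : Finset α → ℝ}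
    (hf : ∀ A : Finset α, f A = φ (A ∩ S)) :
    ∑ γ ∈ M'.powerset with p γ, (f (γ ∪ C) - f (M' \ γ ∪ C)) * G γ =
      ∑ γ ∈ M'.powerset with p γ, (φ (γ ∩ S) - φ (S \ (γ ∩ S))) * G γ := by
  refine Finset.sum_congr rfl fun γ _ => ?_
  have hCS : ∀ e ∈ C, e ∉ S := fun e he hs => Finset.disjoint_left.1 hSC hs he
  have h1 : (γ ∪ C) ∩ S = γ ∩ S := by
    ext e
    simp only [Finset.mem_inter, Finset.mem_union]
    constructor
    · rintro ⟨h | h, hs⟩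
      · exact ⟨h, hs⟩
      · exact absurd hs (hCS e h)
    · rintro ⟨h, hs⟩
      exact ⟨Or.inl h, hs⟩
  have h2 : (M' \ γ ∪ C) ∩ S = S \ (γ ∩ S) := by
    ext e
    simp only [Finset.mem_inter, Finset.mem_union, Finset.mem_sdiff]
    constructor
    · rintro ⟨⟨_, hγ⟩ | h, hs⟩
      · exact ⟨hs, fun h => hγ h.1⟩
      · exact absurd hs (hCS e h)
    · rintro ⟨hs, h⟩
      exact ⟨Or.inl ⟨hSM hs, fun hγ => h ⟨hγ, hs⟩⟩, hs⟩
  rw [hf (γ ∪ C), hf (M' \ γ ∪ C), h1, h2]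

/-- **Cone transfer.**  If the odd part of `φ` on the patterns of `S` is a nonnegative combination
`φ(P) − φ(S \ P) = Σ_r c_r (ψ_r(P) − ψ_r(S \ P))` (`c_r ≥ 0`) and every `ψ_r` satisfies the antipodal inequality, so does `φ`. [folklore] -/
theorem pattern_sum_nonpos_of_cone {M' S : Finset α} (p : Finset α → Prop) [DecidablePred p] (G : Finset α → ℝ)
    {ι : Type*} (R : Finset ι) (c : ι → ℝ) (hc : ∀ r ∈ R, 0 ≤ c r) (φ : Finset α → ℝ) (ψ : ι → Finset α → ℝ)
    (hdec : ∀ P : Finset α, P ⊆ S → φ P - φ (S \ P) = ∑ r ∈ R, c r * (ψ r P - ψ r (S \ P)))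
    (hray : ∀ r ∈ R, ∑ γ ∈ M'.powerset with p γ, (ψ r (γ ∩ S) - ψ r (S \ (γ ∩ S))) * G γ ≤ 0) :
    ∑ γ ∈ M'.powerset with p γ, (φ (γ ∩ S) - φ (S \ (γ ∩ S))) * G γ ≤ 0 := by
  have h1 : ∀ γ ∈ M'.powerset.filter (fun γ => p γ), (φ (γ ∩ S) - φ (S \ (γ ∩ S))) * G γ =
      ∑ r ∈ R, c r * ((ψ r (γ ∩ S) - ψ r (S \ (γ ∩ S))) * G γ) := fun γ _ => by
    rw [hdec _ Finset.inter_subset_right, Finset.sum_mul]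
    exact Finset.sum_congr rfl fun r _ => by ring
  rw [Finset.sum_congr rfl h1, Finset.sum_comm]
  refine Finset.sum_nonpos fun r hr => ?_
  rw [← Finset.mul_sum]
  exact mul_nonpos_of_nonneg_of_nonpos (hc r hr) (hray r hr)

/-- **Layer cake (pattern form).**  If every THRESHOLD indicator `1{t ≤ φ}` satisfies the antipodal inequality, so does `φ` — for any real
`φ` (no monotonicity needed): `φ = t₀ + Σ_j (t_j − t_{j−1})·1{t_j ≤ φ}` over the values `t₀ < t₁ < …` of `φ` on the patterns of `S`, and the
antipodal sum is linear in `φ` and kills constants.  Proof: induction on the number of values, peeling the top layer. [folklore] -/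
theorem pattern_sum_nonpos_of_thresholds {M' S : Finset α} (p : Finset α → Prop) [DecidablePred p] (G : Finset α → ℝ)
    (φ : Finset α → ℝ)
    (hthr : ∀ t : ℝ, ∑ γ ∈ M'.powerset with p γ,
        ((if t ≤ φ (γ ∩ S) then (1 : ℝ) else 0) - (if t ≤ φ (S \ (γ ∩ S)) then 1 else 0)) * G γ ≤ 0) :
    ∑ γ ∈ M'.powerset with p γ, (φ (γ ∩ S) - φ (S \ (γ ∩ S))) * G γ ≤ 0 := by
  suffices key : ∀ (n : ℕ) (φ : Finset α → ℝ), (S.powerset.image φ).card ≤ n →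
      (∀ t : ℝ, ∑ γ ∈ M'.powerset with p γ,
        ((if t ≤ φ (γ ∩ S) then (1 : ℝ) else 0) - (if t ≤ φ (S \ (γ ∩ S)) then 1 else 0)) * G γ ≤ 0) →
      ∑ γ ∈ M'.powerset with p γ, (φ (γ ∩ S) - φ (S \ (γ ∩ S))) * G γ ≤ 0 from key _ φ le_rfl hthr
  intro n
  induction n with
  | zero =>
    intro φ hn _
    exact absurd hn (not_le.2 (Finset.card_pos.2 ⟨φ ∅, Finset.mem_image_of_mem _ (Finset.empty_mem_powerset _)⟩))
  | succ n ih =>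
    intro φ hn hthr
    have hPS : ∀ γ : Finset α, γ ∩ S ∈ S.powerset := fun γ => Finset.mem_powerset.2 Finset.inter_subset_right
    have hQS : ∀ γ : Finset α, S \ (γ ∩ S) ∈ S.powerset := fun γ => Finset.mem_powerset.2 Finset.sdiff_subset
    have hne : (S.powerset.image φ).Nonempty := ⟨φ ∅, Finset.mem_image_of_mem _ (Finset.empty_mem_powerset _)⟩
    set t : ℝ := (S.powerset.image φ).max' hne with htdef
    by_cases hc : ((S.powerset.image φ).erase t).Nonempty
    · -- inductive step: peel the top layer `{φ = t}`
      set t' : ℝ := ((S.powerset.image φ).erase t).max' hc with ht'def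
      have ht'mem : t' ∈ (S.powerset.image φ).erase t := Finset.max'_mem _ hc
      have htt' : t' < t :=
        lt_of_le_of_ne (Finset.le_max' _ _ (Finset.mem_of_mem_erase ht'mem)) (Finset.mem_erase.1 ht'mem).1
      set φ' : Finset α → ℝ := fun Q => min (φ Q) t' with hφ'def
      have hdecomp : ∀ Q ∈ S.powerset, φ Q = φ' Q + (t - t') * (if t ≤ φ Q then (1 : ℝ) else 0) := by
        intro Q hQ
        have hQv : φ Q ∈ S.powerset.image φ := Finset.mem_image_of_mem _ hQ
        have hle : φ Q ≤ t := Finset.le_max' _ _ hQv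
        by_cases h : t ≤ φ Q
        · have heq : φ Q = t := le_antisymm hle h
          have hmin : φ' Q = t' := by
            show min (φ Q) t' = t'
            rw [heq]
            exact min_eq_right htt'.le
          rw [if_pos h, hmin, heq]
          ring
        · have hQ' : φ Q ∈ (S.powerset.image φ).erase t := Finset.mem_erase.2 ⟨(not_le.1 h).ne, hQv⟩
          have hmin : φ' Q = φ Q := min_eq_left (Finset.le_max' _ _ hQ')
          rw [if_neg h, hmin]
          ring
      have hcard : (S.powerset.image φ').card ≤ n := by
        have hsub : S.powerset.image φ' ⊆ (S.powerset.image φ).erase t := by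
          intro v hv
          obtain ⟨Q, hQ, rfl⟩ := Finset.mem_image.1 hv
          by_cases h : φ Q ≤ t'
          · have hmin : φ' Q = φ Q := min_eq_left h
            rw [hmin]
            exact Finset.mem_erase.2 ⟨(lt_of_le_of_lt h htt').ne, Finset.mem_image_of_mem _ hQ⟩
          · have hmin : φ' Q = t' := min_eq_right (not_le.1 h).le
            rw [hmin]
            exact ht'mem
        have h1 := Finset.card_le_card hsub
        have h2 := Finset.card_erase_of_mem (Finset.max'_mem _ hne)
        rw [← htdef] at h2
        omega
      have hthr' : ∀ s : ℝ, ∑ γ ∈ M'.powerset with p γ,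
          ((if s ≤ φ' (γ ∩ S) then (1 : ℝ) else 0) - (if s ≤ φ' (S \ (γ ∩ S)) then 1 else 0)) * G γ ≤ 0 := by
        intro s
        by_cases hs : s ≤ t'
        · have e : ∀ Q : Finset α, (s ≤ φ' Q ↔ s ≤ φ Q) := fun Q => by
            show s ≤ min (φ Q) t' ↔ s ≤ φ Q
            rw [le_min_iff, and_iff_left hs]
          simp only [e]
          exact hthr s
        · have e : ∀ Q : Finset α, ¬ s ≤ φ' Q := fun Q h => hs (h.trans (min_le_right _ _))
          simp only [e, if_false, sub_self, zero_mul, Finset.sum_const_zero]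
          exact le_rfl
      have hlin : ∑ γ ∈ M'.powerset with p γ, (φ (γ ∩ S) - φ (S \ (γ ∩ S))) * G γ =
          ∑ γ ∈ M'.powerset with p γ, (φ' (γ ∩ S) - φ' (S \ (γ ∩ S))) * G γ +
            (t - t') * ∑ γ ∈ M'.powerset with p γ,
              ((if t ≤ φ (γ ∩ S) then (1 : ℝ) else 0) - (if t ≤ φ (S \ (γ ∩ S)) then 1 else 0)) * G γ := by
        rw [Finset.mul_sum, ← Finset.sum_add_distrib]
        refine Finset.sum_congr rfl fun γ _ => ?_
        have lin : ∀ a b a' b' u v : ℝ, a = a' + (t - t') * u → b = b' + (t - t') * v →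
            (a - b) * G γ = (a' - b') * G γ + (t - t') * ((u - v) * G γ) := by
          intro a b a' b' u v ha hb
          rw [ha, hb]
          ring
        exact lin _ _ _ _ _ _ (hdecomp _ (hPS γ)) (hdecomp _ (hQS γ))
      rw [hlin]
      exact add_nonpos (ih φ' hcard hthr') (mul_nonpos_of_nonneg_of_nonpos (sub_nonneg.2 htt'.le) (hthr t))
    · -- one value: `φ` is constant on the patterns, the sum vanishes
      have hconst : ∀ Q ∈ S.powerset, φ Q = t := by
        intro Q hQ
        by_contra h
        exact hc ⟨φ Q, Finset.mem_erase.2 ⟨h, Finset.mem_image_of_mem _ hQ⟩⟩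
      have h0 : ∀ γ ∈ M'.powerset.filter (fun γ => p γ), (φ (γ ∩ S) - φ (S \ (γ ∩ S))) * G γ = 0 :=
        fun γ _ => by rw [hconst _ (hPS γ), hconst _ (hQS γ), sub_self, zero_mul]
      rw [Finset.sum_congr rfl h0, Finset.sum_const_zero]

/-- **Layer cake (edge form).**  `S ⊆ M'` special edges off the contracted set `C`, `f` reading only `S`; if every threshold indicator
`1{t ≤ f}` (a monotone Boolean function of the specials when `f` is increasing) satisfies
`Σ_{γ ⊆ M', p γ} (1{t ≤ f(γ ∪ C)} − 1{t ≤ f((M' \ γ) ∪ C)})·G γ ≤ 0`, then `Σ_{γ ⊆ M', p γ} (f(γ ∪ C) − f((M' \ γ) ∪ C))·G γ ≤ 0`.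
This reduces `C_∞⁺` at level `k` for every increasing real `f` to the finitely many monotone Boolean types. [folklore] -/
theorem sum_antipodal_nonpos_of_thresholds {M' C S : Finset α} (hSM : S ⊆ M') (hSC : Disjoint S C)
    (p : Finset α → Prop) [DecidablePred p] (G : Finset α → ℝ) {f : Finset α → ℝ}
    (hf : ∀ A B : Finset α, (∀ e ∈ S, (e ∈ A ↔ e ∈ B)) → f A = f B)
    (hthr : ∀ t : ℝ, ∑ γ ∈ M'.powerset with p γ,
        ((if t ≤ f (γ ∪ C) then (1 : ℝ) else 0) - (if t ≤ f (M' \ γ ∪ C) then 1 else 0)) * G γ ≤ 0) :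
    ∑ γ ∈ M'.powerset with p γ, (f (γ ∪ C) - f (M' \ γ ∪ C)) * G γ ≤ 0 := by
  have hf' : ∀ A : Finset α, f A = f (A ∩ S) := apply_eq_apply_inter_of_reads hf
  rw [sum_antipodal_congr_pattern hSM hSC p G hf']
  refine pattern_sum_nonpos_of_thresholds p G f fun t => ?_
  have hft : ∀ A : Finset α, (fun A => if t ≤ f A then (1 : ℝ) else 0) A =
      (fun Q => if t ≤ f Q then (1 : ℝ) else 0) (A ∩ S) := fun A => by
    show (if t ≤ f A then (1 : ℝ) else 0) = if t ≤ f (A ∩ S) then 1 else 0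
    rw [← hf' A]
  have eq := sum_antipodal_congr_pattern hSM hSC p G (f := fun A => if t ≤ f A then (1 : ℝ) else 0)
    (φ := fun Q => if t ≤ f Q then (1 : ℝ) else 0) hft
  beta_reduce at eq
  rw [← eq]
  exact hthr t

/-- **Cone transfer (edge form).**  `S ⊆ M'` special edges off `C`; `f` and the ray functions `f_r` read only `S`; if on the patterns
`f(P) − f(S \ P) = Σ_r c_r (f_r(P) − f_r(S \ P))` with `c_r ≥ 0` and every ray satisfies the antipodal inequality, so does `f`. [folklore] -/
theorem sum_antipodal_nonpos_of_cone {M' C S : Finset α} (hSM : S ⊆ M') (hSC : Disjoint S C)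
    (p : Finset α → Prop) [DecidablePred p] (G : Finset α → ℝ) {ι : Type*} (R : Finset ι) (c : ι → ℝ)
    (hc : ∀ r ∈ R, 0 ≤ c r) {f : Finset α → ℝ} (fr : ι → Finset α → ℝ)
    (hf : ∀ A B : Finset α, (∀ e ∈ S, (e ∈ A ↔ e ∈ B)) → f A = f B)
    (hfr : ∀ r ∈ R, ∀ A B : Finset α, (∀ e ∈ S, (e ∈ A ↔ e ∈ B)) → fr r A = fr r B)
    (hdec : ∀ P : Finset α, P ⊆ S → f P - f (S \ P) = ∑ r ∈ R, c r * (fr r P - fr r (S \ P)))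
    (hray : ∀ r ∈ R, ∑ γ ∈ M'.powerset with p γ, (fr r (γ ∪ C) - fr r (M' \ γ ∪ C)) * G γ ≤ 0) :
    ∑ γ ∈ M'.powerset with p γ, (f (γ ∪ C) - f (M' \ γ ∪ C)) * G γ ≤ 0 := by
  have hf' : ∀ A : Finset α, f A = f (A ∩ S) := apply_eq_apply_inter_of_reads hf
  rw [sum_antipodal_congr_pattern hSM hSC p G hf']
  refine pattern_sum_nonpos_of_cone p G R c hc f fr hdec fun r hr => ?_
  have hfr' : ∀ A : Finset α, fr r A = fr r (A ∩ S) := apply_eq_apply_inter_of_reads (hfr r hr)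
  rw [← sum_antipodal_congr_pattern hSM hSC p G hfr']
  exact hray r hr

end OddCone

end FK

end Summit.CriticalPhenomena.PercolationContinuityZ3.Theorems
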